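import Mathlib
import Summits.ValiantsHypothesis.ValiantsHypothesis.Theses.ValuativeGCT
import Summits.ValiantsHypothesis.ValiantsHypothesis.Theorems.ValuativeGCTValuativeFlipFourRowSliceBound
import Summits.ValiantsHypothesis.ValiantsHypothesis.Theorems.ValuativeGCTCutBitesHwExtraction

/-!
# Isotypic slice bound, part 1: row weights and the split-scalar Krylov slice

Tools for the ISOTYPIC (shape-dependent) det-side census of crux `ValuativeGCT.ValuativeFlip`
(stmt-ValiantsHypothesis-12624; wall-breaker axis "det-orbit-closure multiplicity bounds for
detCensus"), file `…IsotypicSliceBound` (part 2) states the bounds.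

`W = ℂ^{N×N}`, `N = t + 2`; `R = ℂ[End W] = MvPolynomial (MatIdx N × MatIdx N) ℂ` with variables
`X (j, i)` (row slot `j`, matrix position `i`).  The landed four-row slice bound
(`…FourRowSliceBound`: `frProj`, `fr_eq_zero_of_aeval_frProj`) restricts row-wise unimodular
sandwich invariants INJECTIVELY to the Krylov slice `{A_{j₀} = u·1, A_{j₁} = u·shift + last column,
A_j free}` for any two kept slots `j₀ ≠ j₁`.  Here the slice is refined by the ROW TORI:

* `iso_isWeightedHomogeneous_of_semiInvariant` — a `B`-semi-invariant of weight `χ` (the crux's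
  Borel clause) is weighted homogeneous of weight `-χ` for the row weights `X (j, i) ↦ 𝟙_j`
  (every monomial has row-degree vector `-χ`; `hwx_weight_eq_neg_rowDegrees`);
* `isoProj` — the slice projection with the shared scalar split into `u₀` (slot `j₀`) and `u₁`
  (slot `j₁`); it specialises to `frProj` (`aeval_frProj_eq_aeval_isoSpec`), so it is still injective
  on sandwich invariants, and it is EQUIVARIANT: each coordinate is weighted homogeneous of weight
  `𝟙_{slot}` for the slot weights `isoSlot` of the slice variables (`isoProj_isWeightedHomogeneous`,
  transported through `aeval` by `iso_isWeightedHomogeneous_aeval`);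
* `iso_finrank_le_of_le` — slice polynomials of a fixed row weight `d` span at most
  `∏ v, isoBound d v` dimensions (exponent vectors of row weight `d` inject into a box: forget `u₀`,
  whose exponent is the weight at `j₀`, `isoTrunc_injOn`);
* `iso_core` — hence a space of degree-`D` sandwich invariants, supported on the kept slots and
  semi-invariant of weight `χ`, has dimension `≤ ∏ v, isoBound (-χ) v`
  `= (d j₁ + 1)^(N+1) · ∏_{j ∈ S ∖ {j₀,j₁}} (d j + 1)^(N²)` (`iso_prod_isoBound_eq`), `d = (-χ)⁺` —
  no dependence on `D` nor on the weight at the scalar slot `j₀`.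

Elementary (Zariski density is imported from part B1/four-row; the rest is torus bookkeeping);
no named facts, no new objects of the route (the `def`s are proof-internal coordinates).
-/

set_option linter.dupNamespace false

namespace Summit.ValiantsHypothesis.ValiantsHypothesis.Theorems.ValuativeFlip

open MvPolynomial
open scoped BigOperators Matrix
open Literature.NumberTheory.DiophantineGeometry
open Summit.ValiantsHypothesis.ValiantsHypothesis.Theorems.CutBitesAdjugate

noncomputable section

/-- Row weights as functions: the weight `∑ e(v) • 𝟙_{slot v}` of an exponent vector `e`, read at a
slot `j`, is the total exponent of `e` on the variables of slot `j`. [folklore] -/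
theorem iso_weight_apply {V ι : Type*} [DecidableEq ι] (slot : V → ι) (e : V →₀ ℕ) (j : ι) :
    Finsupp.weight (fun v => (Pi.single (slot v) (1 : ℤ) : ι → ℤ)) e j =
      ((∑ q ∈ e.support with slot q = j, e q : ℕ) : ℤ) := by
  classical
  rw [Finsupp.weight_apply, Finsupp.sum, Finset.sum_apply, Nat.cast_sum, Finset.sum_filter]
  refine Finset.sum_congr rfl fun q _ => ?_
  rw [Pi.smul_apply, Pi.single_apply]
  by_cases h : slot q = j
  · rw [if_pos h.symm, if_pos h, nsmul_eq_mul, mul_one]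
  · rw [if_neg (Ne.symm h), if_neg h, smul_zero]

/-- A single exponent is at most the row weight of its slot. [folklore] -/
theorem iso_le_weight_apply {V ι : Type*} [DecidableEq ι] (slot : V → ι) (e : V →₀ ℕ) (v : V) :
    (e v : ℤ) ≤ Finsupp.weight (fun v => (Pi.single (slot v) (1 : ℤ) : ι → ℤ)) e (slot v) := by
  classical
  rw [iso_weight_apply, Nat.cast_le]
  by_cases hv : v ∈ e.support
  · exact Finset.single_le_sum (f := fun q => e q) (fun q _ => Nat.zero_le _)
      (Finset.mem_filter.mpr ⟨hv, rfl⟩)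
  · rw [Finsupp.notMem_support_iff.mp hv]
    exact Nat.zero_le _

/-- **Weighted substitution.** If every `f p` is weighted homogeneous of weight `w₁ p` for the
target weights `w₂`, then `aeval f` maps `w₁`-weighted homogeneous polynomials of weight `n` to
`w₂`-weighted homogeneous polynomials of weight `n`. [folklore] -/
theorem iso_isWeightedHomogeneous_aeval {σ τ R M : Type*} [CommSemiring R] [AddCommMonoid M]
    {w₁ : σ → M} {w₂ : τ → M} {f : σ → MvPolynomial τ R}
    (hf : ∀ p, IsWeightedHomogeneous w₂ (f p) (w₁ p)) {φ : MvPolynomial σ R} {n : M}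
    (hφ : IsWeightedHomogeneous w₁ φ n) : IsWeightedHomogeneous w₂ (aeval f φ) n := by
  classical
  rw [φ.as_sum, map_sum]
  refine IsWeightedHomogeneous.sum _ _ _ fun d hd => ?_
  have hdn : Finsupp.weight w₁ d = n := hφ (mem_support_iff.mp hd)
  rw [aeval_monomial, ← hdn, Finsupp.weight_apply, Finsupp.prod, Finsupp.sum]
  rw [show (∑ i ∈ d.support, d i • w₁ i) = 0 + ∑ i ∈ d.support, d i • w₁ i from (zero_add _).symm]
  exact (isWeightedHomogeneous_C w₂ _).mul
    (IsWeightedHomogeneous.prod _ _ _ fun i _ => (hf i).pow _)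

/-- **Semi-invariants are multihomogeneous in the row slots.** A `B`-semi-invariant `G` of weight
`χ` for the left translation `X (j, i) ↦ ∑ l, (g⁻¹) j l • X (l, i)` (the crux's Borel clause) is
weighted homogeneous of weight `-χ` for the row weights `X (j, i) ↦ 𝟙_j`: every monomial of `G`
has row-degree vector `-χ` (`hwx_weight_eq_neg_rowDegrees`). [folklore: Fulton–Harris §15.5] -/
theorem iso_isWeightedHomogeneous_of_semiInvariant : ∀ {m : ℕ} (χ : Weight (MatIdx m)) (G : MvPolynomial (MatIdx m × MatIdx m) ℂ), (∀ g : Matrix.GeneralLinearGroup (MatIdx m) ℂ, IsUpperTriangular g → MvPolynomial.aeval (R := ℂ) (fun p : MatIdx m × MatIdx m => ∑ l : MatIdx m, ((g⁻¹ : Matrix.GeneralLinearGroup (MatIdx m) ℂ) : Matrix (MatIdx m) (MatIdx m) ℂ) p.1 l • (MvPolynomial.X (l, p.2) : MvPolynomial (MatIdx m × MatIdx m) ℂ)) G = weightChar χ g • G) → MvPolynomial.IsWeightedHomogeneous (fun p : MatIdx m × MatIdx m => (Pi.single p.1 (1 : ℤ) : MatIdx m → ℤ)) G (-χ) := by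
  intro m χ G hG
  classical
  intro s hs
  have hχ := hwx_weight_eq_neg_rowDegrees (fun t ht => hG t ht.isUpperTriangular) hs
  funext j
  rw [iso_weight_apply, Pi.neg_apply, hχ, neg_neg]


/-! ## The split-scalar slice -/

section Slice

variable (t : ℕ)
variable (S : Set (MatIdx (t + 2))) (j₀ j₁ : MatIdx (t + 2))

/-- The slice variables with the shared scalar SPLIT in two: `u₀ = inl false` (the scalar of slot
`j₀`), `u₁ = inl true` (the subdiagonal scalar of slot `j₁`), the last column of slot `j₁`, and all
entries of the kept slots `j ∈ S ∖ {j₀, j₁}`. [folklore] -/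
abbrev isoVar : Type :=
  Bool ⊕ (Fin (t + 2) ⊕ {p : MatIdx (t + 2) × MatIdx (t + 2) // p.1 ∈ S ∧ ¬(p.1 = j₀ ∨ p.1 = j₁)})

/-- The row slot of a slice variable: `u₀ ↦ j₀`; `u₁` and the last column of slot `j₁` `↦ j₁`;
an entry of a free kept slot `↦` its slot. [folklore] -/
def isoSlot : isoVar t S j₀ j₁ → MatIdx (t + 2)
  | Sum.inl false => j₀
  | Sum.inl true => j₁
  | Sum.inr (Sum.inl _) => j₁
  | Sum.inr (Sum.inr q) => q.1.1

variable {S j₀ j₁} in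
/-- The only slice variable of slot `j₀` is `u₀`. [folklore] -/
theorem isoSlot_eq_iff (h01 : j₀ ≠ j₁) (v : isoVar t S j₀ j₁) :
    isoSlot t S j₀ j₁ v = j₀ ↔ v = Sum.inl false := by
  rcases v with (_ | _) | (a | q)
  · simp [isoSlot]
  · simp [isoSlot, h01.symm]
  · simp [isoSlot, h01.symm]
  · have hq : ¬(q.1.1 = j₀ ∨ q.1.1 = j₁) := q.2.2
    simp only [isoSlot, reduceCtorEq, iff_false]
    exact fun h => hq (Or.inl h)

variable {S j₀ j₁} in
/-- The row weight of an exponent vector at slot `j₀` is its exponent at `u₀`. [folklore] -/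
theorem iso_weight_apply_j₀ (h01 : j₀ ≠ j₁) (e : isoVar t S j₀ j₁ →₀ ℕ) :
    Finsupp.weight (fun v => (Pi.single (isoSlot t S j₀ j₁ v) (1 : ℤ) : MatIdx (t + 2) → ℤ)) e j₀ =
      (e (Sum.inl false) : ℤ) := by
  classical
  rw [iso_weight_apply]
  congr 1
  rw [Finset.sum_filter, Finset.sum_eq_single (Sum.inl false)]
  · simp [isoSlot]
  · intro q _ hq
    rw [if_neg (fun h => hq ((isoSlot_eq_iff t h01 q).mp h))]
  · intro hm
    rw [Finsupp.notMem_support_iff.mp hm]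
    simp

/-- Per-variable exponent bound on the target: `u₀` is pinned (one value), every other variable
`v` is bounded by the row weight `d (isoSlot v)`. [folklore] -/
def isoBound (d : MatIdx (t + 2) → ℤ) : isoVar t S j₀ j₁ → ℕ
  | Sum.inl false => 1
  | Sum.inl true => (d j₁).toNat + 1
  | Sum.inr (Sum.inl _) => (d j₁).toNat + 1
  | Sum.inr (Sum.inr q) => (d q.1.1).toNat + 1

/-- Truncation of an exponent vector to the box `∏ v, Fin (isoBound d v)` (forgetting `u₀`).
[folklore] -/
def isoTrunc (d : MatIdx (t + 2) → ℤ) (e : isoVar t S j₀ j₁ →₀ ℕ) :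
    (v : isoVar t S j₀ j₁) → Fin (isoBound t S j₀ j₁ d v)
  | Sum.inl false => ⟨0, Nat.one_pos⟩
  | Sum.inl true => ⟨min (e (Sum.inl true)) (d j₁).toNat, by
      show _ < (d j₁).toNat + 1
      omega⟩
  | Sum.inr (Sum.inl a) => ⟨min (e (Sum.inr (Sum.inl a))) (d j₁).toNat, by
      show _ < (d j₁).toNat + 1
      omega⟩
  | Sum.inr (Sum.inr q) => ⟨min (e (Sum.inr (Sum.inr q))) (d q.1.1).toNat, by
      show _ < (d q.1.1).toNat + 1
      omega⟩

variable {S j₀ j₁} in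
/-- On exponent vectors of row weight `d` the truncation forgets nothing but `u₀`. [folklore] -/
theorem isoTrunc_val_eq {d : MatIdx (t + 2) → ℤ} {e : isoVar t S j₀ j₁ →₀ ℕ}
    (he : Finsupp.weight (fun v => (Pi.single (isoSlot t S j₀ j₁ v) (1 : ℤ) : MatIdx (t + 2) → ℤ)) e = d)
    (v : isoVar t S j₀ j₁) (hv : v ≠ Sum.inl false) :
    ((isoTrunc t S j₀ j₁ d e v : Fin _) : ℕ) = e v := by
  have hle : (e v : ℤ) ≤ d (isoSlot t S j₀ j₁ v) := by
    rw [← he]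
    exact iso_le_weight_apply _ e v
  have hle' : e v ≤ (d (isoSlot t S j₀ j₁ v)).toNat := by
    have := Int.self_le_toNat (d (isoSlot t S j₀ j₁ v))
    omega
  rcases v with (_ | _) | (a | q)
  · exact absurd rfl hv
  · exact min_eq_left hle'
  · exact min_eq_left hle'
  · exact min_eq_left hle'

variable {S j₀ j₁} in
/-- The truncation is injective on exponent vectors of a fixed row weight `d`: `u₀`'s exponent is
the weight at `j₀`. [folklore] -/
theorem isoTrunc_injOn (h01 : j₀ ≠ j₁) (d : MatIdx (t + 2) → ℤ) :
    Set.InjOn (isoTrunc t S j₀ j₁ d)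
      {e | Finsupp.weight (fun v => (Pi.single (isoSlot t S j₀ j₁ v) (1 : ℤ) : MatIdx (t + 2) → ℤ)) e = d} := by
  intro e he e' he' h
  ext v
  by_cases hv : v = Sum.inl false
  · subst hv
    have h1 := iso_weight_apply_j₀ t h01 e
    have h2 := iso_weight_apply_j₀ t h01 e'
    rw [he] at h1
    rw [he'] at h2
    exact_mod_cast h1.symm.trans h2
  · rw [← isoTrunc_val_eq t he v hv, ← isoTrunc_val_eq t he' v hv, h]

variable [DecidablePred (· ∈ S)]

/-- The split-scalar slice projection: as `frProj`, but slot `j₀`'s diagonal goes to `u₀` and slot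
`j₁`'s subdiagonal to `u₁`. [folklore] -/
def isoProj (p : MatIdx (t + 2) × MatIdx (t + 2)) : MvPolynomial (isoVar t S j₀ j₁) ℂ :=
  if h0 : p.1 = j₀ then
    (if (ofLex p.2).1 = (ofLex p.2).2 then X (Sum.inl false) else 0)
  else if h1 : p.1 = j₁ then
    (if (ofLex p.2).2 = Fin.last (t + 1) then X (Sum.inr (Sum.inl (ofLex p.2).1))
      else if ((ofLex p.2).1 : ℕ) = (ofLex p.2).2 + 1 then X (Sum.inl true) else 0)
  else if hS : p.1 ∈ S then X (Sum.inr (Sum.inr ⟨p, hS, not_or.mpr ⟨h0, h1⟩⟩))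
  else 0

/-- The specialisation `u₀, u₁ ↦ u` back to the slice variables `frVar` of the four-row slice
bound. [folklore] -/
def isoSpec : isoVar t S j₀ j₁ → MvPolynomial (frVar t S j₀ j₁) ℂ
  | Sum.inl _ => X (Sum.inl ())
  | Sum.inr x => X (Sum.inr x)

/-- Specialising the split scalars recovers the slice projection `frProj`. [folklore] -/
theorem aeval_isoSpec_isoProj (p : MatIdx (t + 2) × MatIdx (t + 2)) :
    aeval (isoSpec t S j₀ j₁) (isoProj t S j₀ j₁ p) = frProj t S j₀ j₁ p := by
  unfold isoProj frProj
  split_ifs <;> simp [isoSpec]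

/-- `aeval frProj = aeval isoSpec ∘ aeval isoProj`. [folklore] -/
theorem aeval_frProj_eq_aeval_isoSpec (G : MvPolynomial (MatIdx (t + 2) × MatIdx (t + 2)) ℂ) :
    aeval (frProj t S j₀ j₁) G = aeval (isoSpec t S j₀ j₁) (aeval (isoProj t S j₀ j₁) G) := by
  have h : frProj t S j₀ j₁ = fun p => aeval (isoSpec t S j₀ j₁) (isoProj t S j₀ j₁ p) :=
    funext fun p => (aeval_isoSpec_isoProj t S j₀ j₁ p).symm
  rw [← AlgHom.comp_apply, MvPolynomial.comp_aeval, ← h]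

/-- **Equivariance of the slice projection for the row tori.** Each coordinate `isoProj p` is
weighted homogeneous of weight `𝟙_{p.1}` when the slice variable `v` is given the weight
`𝟙_{isoSlot v}`. [folklore] -/
theorem isoProj_isWeightedHomogeneous (p : MatIdx (t + 2) × MatIdx (t + 2)) :
    IsWeightedHomogeneous
      (fun v => (Pi.single (isoSlot t S j₀ j₁ v) (1 : ℤ) : MatIdx (t + 2) → ℤ))
      (isoProj t S j₀ j₁ p) (Pi.single p.1 (1 : ℤ) : MatIdx (t + 2) → ℤ) := by
  have key : ∀ v : isoVar t S j₀ j₁, isoSlot t S j₀ j₁ v = p.1 →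
      IsWeightedHomogeneous
        (fun v => (Pi.single (isoSlot t S j₀ j₁ v) (1 : ℤ) : MatIdx (t + 2) → ℤ))
        (X v : MvPolynomial (isoVar t S j₀ j₁) ℂ) (Pi.single p.1 (1 : ℤ) : MatIdx (t + 2) → ℤ) := by
    intro v hv
    have h := isWeightedHomogeneous_X (R := ℂ)
      (fun v => (Pi.single (isoSlot t S j₀ j₁ v) (1 : ℤ) : MatIdx (t + 2) → ℤ)) v
    rwa [hv] at h
  unfold isoProj
  split_ifs with h0 h00 h1 h1l h1s hS
  · exact key (Sum.inl false) (by simp only [isoSlot]; exact h0.symm)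
  · exact isWeightedHomogeneous_zero _ _ _
  · exact key (Sum.inr (Sum.inl (ofLex p.2).1)) (by simp only [isoSlot]; exact h1.symm)
  · exact key (Sum.inl true) (by simp only [isoSlot]; exact h1.symm)
  · exact isWeightedHomogeneous_zero _ _ _
  · exact key (Sum.inr (Sum.inr ⟨p, hS, not_or.mpr ⟨h0, h1⟩⟩)) (by simp only [isoSlot])
  · exact isWeightedHomogeneous_zero _ _ _

variable {S j₀ j₁} in
/-- **Relative count.** A finite-dimensional space of slice polynomials all of row weight `d` has
dimension at most `∏ v, isoBound d v`. [folklore] -/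
theorem iso_finrank_le_of_le (h01 : j₀ ≠ j₁) (d : MatIdx (t + 2) → ℤ)
    (V : Submodule ℂ (MvPolynomial (isoVar t S j₀ j₁) ℂ)) [Module.Finite ℂ V]
    (hV : V ≤ weightedHomogeneousSubmodule ℂ
        (fun v => (Pi.single (isoSlot t S j₀ j₁ v) (1 : ℤ) : MatIdx (t + 2) → ℤ)) d) :
    Module.finrank ℂ ↥V ≤ ∏ v, isoBound t S j₀ j₁ d v := by
  classical
  set w₂ : isoVar t S j₀ j₁ → MatIdx (t + 2) → ℤ := fun v => Pi.single (isoSlot t S j₀ j₁ v) (1 : ℤ)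
    with hw₂
  let E : Type := {e : isoVar t S j₀ j₁ →₀ ℕ // Finsupp.weight w₂ e = d}
  let ι : E → ((v : isoVar t S j₀ j₁) → Fin (isoBound t S j₀ j₁ d v)) :=
    fun e => isoTrunc t S j₀ j₁ d e.1
  have hι : Function.Injective ι := fun e e' h =>
    Subtype.ext (isoTrunc_injOn t h01 d e.2 e'.2 h)
  letI : Fintype E := Fintype.ofInjective ι hι
  let b : E → MvPolynomial (isoVar t S j₀ j₁) ℂ := fun e => monomial e.1 1
  have hle : weightedHomogeneousSubmodule ℂ w₂ d ≤ Submodule.span ℂ (Set.range b) := by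
    intro φ hφ
    rw [mem_weightedHomogeneousSubmodule] at hφ
    rw [φ.as_sum]
    refine Submodule.sum_mem _ fun s hs => ?_
    have hsd : Finsupp.weight w₂ s = d := hφ (mem_support_iff.mp hs)
    have : monomial s (coeff s φ) = coeff s φ • b ⟨s, hsd⟩ := by
      rw [smul_monomial, smul_eq_mul, mul_one]
    rw [this]
    exact Submodule.smul_mem _ _ (Submodule.subset_span (Set.mem_range_self _))
  haveI : Module.Finite ℂ (Submodule.span ℂ (Set.range b)) :=
    Module.Finite.iff_fg.mpr (Submodule.fg_span (Set.finite_range b))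
  calc Module.finrank ℂ ↥V
      ≤ Module.finrank ℂ (Submodule.span ℂ (Set.range b)) := Submodule.finrank_mono (hV.trans hle)
    _ ≤ Fintype.card E := finrank_range_le_card b
    _ ≤ Fintype.card ((v : isoVar t S j₀ j₁) → Fin (isoBound t S j₀ j₁ d v)) :=
        Fintype.card_le_of_injective ι hι
    _ = ∏ v, isoBound t S j₀ j₁ d v := by
        rw [Fintype.card_pi]
        exact Finset.prod_congr rfl fun v _ => Fintype.card_fin _

variable {S j₀ j₁} in
/-- **The isotypic slice bound, core form** (`N = t + 2`, general kept set `S ∋ j₀, j₁`, general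
weight `χ`).  A space `W` of degree-`D` row-wise unimodular sandwich invariants supported on the
slots of `S` that are `B`-semi-invariant of weight `χ` has dimension at most `∏ v, isoBound (-χ) v`:
the split-scalar slice projection is injective on `W` (Zariski density, `fr_eq_zero_of_aeval_frProj`)
and maps it, equivariantly for the row tori, into slice polynomials of row weight `-χ`.
[folklore: Krylov normal form + torus weights] -/
theorem iso_core (h01 : j₀ ≠ j₁) (hj₀ : j₀ ∈ S) (hj₁ : j₁ ∈ S) (χ : Weight (MatIdx (t + 2)))
    (D : ℕ) (W : Submodule ℂ (MvPolynomial (MatIdx (t + 2) × MatIdx (t + 2)) ℂ))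
    (hWD : W ≤ homogeneousSubmodule (MatIdx (t + 2) × MatIdx (t + 2)) ℂ D)
    (hWS : ∀ G ∈ W, ∀ P Q : Matrix (Fin (t + 2)) (Fin (t + 2)) ℂ, P.det = 1 → Q.det = 1 →
      aeval (sbSubst P Q) G = G)
    (hWsupp : ∀ G ∈ W, G ∈ supported ℂ {p : MatIdx (t + 2) × MatIdx (t + 2) | p.1 ∈ S})
    (hWχ : ∀ G ∈ W, ∀ g : Matrix.GeneralLinearGroup (MatIdx (t + 2)) ℂ, IsUpperTriangular g →
      MvPolynomial.aeval (R := ℂ) (fun p : MatIdx (t + 2) × MatIdx (t + 2) =>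
        ∑ l : MatIdx (t + 2), ((g⁻¹ : Matrix.GeneralLinearGroup (MatIdx (t + 2)) ℂ) :
          Matrix (MatIdx (t + 2)) (MatIdx (t + 2)) ℂ) p.1 l •
            (MvPolynomial.X (l, p.2) : MvPolynomial (MatIdx (t + 2) × MatIdx (t + 2)) ℂ)) G =
        weightChar χ g • G) :
    Module.finrank ℂ ↥W ≤ ∏ v, isoBound t S j₀ j₁ (-χ) v := by
  haveI : Module.Finite ℂ ↥(homogeneousSubmodule (MatIdx (t + 2) × MatIdx (t + 2)) ℂ D) :=
    Module.Finite.iff_fg.mpr (homogeneousSubmodule_fg _ _ _)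
  haveI hWfin : Module.Finite ℂ ↥W := Submodule.finiteDimensional_of_le hWD
  let f : MvPolynomial (MatIdx (t + 2) × MatIdx (t + 2)) ℂ →ₗ[ℂ] MvPolynomial (isoVar t S j₀ j₁) ℂ :=
    (aeval (isoProj t S j₀ j₁)).toLinearMap
  haveI : Module.Finite ℂ ↥(W.map f) :=
    Module.Finite.iff_fg.mpr ((Module.Finite.iff_fg.mp hWfin).map f)
  have hmem : ∀ w : W, f w ∈ W.map f := fun w => Submodule.mem_map_of_mem w.2
  -- injectivity
  have hinj : Function.Injective ((f.domRestrict W).codRestrict (W.map f) hmem) := by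
    rw [injective_iff_map_eq_zero]
    intro w hw
    have hw' : aeval (isoProj t S j₀ j₁) (w : MvPolynomial _ ℂ) = 0 := congrArg Subtype.val hw
    refine Subtype.ext (fr_eq_zero_of_aeval_frProj t h01 hj₀ hj₁ _ (hWS w w.2) (hWsupp w w.2) ?_)
    rw [aeval_frProj_eq_aeval_isoSpec, hw', map_zero]
  -- equivariance
  have himage : W.map f ≤ weightedHomogeneousSubmodule ℂ
      (fun v => (Pi.single (isoSlot t S j₀ j₁ v) (1 : ℤ) : MatIdx (t + 2) → ℤ)) (-χ) := by
    rintro _ ⟨w, hw, rfl⟩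
    exact iso_isWeightedHomogeneous_aeval (isoProj_isWeightedHomogeneous t S j₀ j₁)
      (iso_isWeightedHomogeneous_of_semiInvariant χ w (hWχ w hw))
  exact (LinearMap.finrank_le_finrank_of_injective hinj).trans
    (iso_finrank_le_of_le t h01 (-χ) (W.map f) himage)

/-- **Bookkeeping: the box count in terms of the slots.**  `∏ v, isoBound d v =
(d j₁ + 1)^(N+1) · ∏_{j ∈ S ∖ {j₀, j₁}} (d j + 1)^(N²)`. [folklore] -/
theorem iso_prod_isoBound_eq (d : MatIdx (t + 2) → ℤ) :
    ∏ v, isoBound t S j₀ j₁ d v =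
      ((d j₁).toNat + 1) ^ (t + 3) *
        ∏ j ∈ Finset.univ.filter (fun j : MatIdx (t + 2) => j ∈ S ∧ ¬(j = j₀ ∨ j = j₁)),
          ((d j).toNat + 1) ^ ((t + 2) * (t + 2)) := by
  rw [Fintype.prod_sum_type, Fintype.prod_sum_type, Fintype.prod_bool]
  simp only [isoBound]
  rw [Finset.prod_const, Finset.card_univ, Fintype.card_fin]
  have hfree : ∏ q : {p : MatIdx (t + 2) × MatIdx (t + 2) // p.1 ∈ S ∧ ¬(p.1 = j₀ ∨ p.1 = j₁)},
      ((d q.1.1).toNat + 1) =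
      ∏ j ∈ Finset.univ.filter (fun j : MatIdx (t + 2) => j ∈ S ∧ ¬(j = j₀ ∨ j = j₁)),
        ((d j).toNat + 1) ^ ((t + 2) * (t + 2)) := by
    rw [← Finset.prod_subtype (Finset.univ.filter fun p : MatIdx (t + 2) × MatIdx (t + 2) =>
      p.1 ∈ S ∧ ¬(p.1 = j₀ ∨ p.1 = j₁)) (by simp) (fun p => (d p.1).toNat + 1)]
    rw [show (Finset.univ.filter fun p : MatIdx (t + 2) × MatIdx (t + 2) =>
        p.1 ∈ S ∧ ¬(p.1 = j₀ ∨ p.1 = j₁)) =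
        (Finset.univ.filter fun j : MatIdx (t + 2) => j ∈ S ∧ ¬(j = j₀ ∨ j = j₁)) ×ˢ
          (Finset.univ : Finset (MatIdx (t + 2))) by ext p; simp]
    rw [Finset.prod_product]
    refine Finset.prod_congr rfl fun j _ => ?_
    dsimp only
    rw [Finset.prod_const, Finset.card_univ, Fintype.card_lex, Fintype.card_prod, Fintype.card_fin]
  rw [hfree]
  ring

end Slice

end

end Summit.ValiantsHypothesis.ValiantsHypothesis.Theorems.ValuativeFlip
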